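import Summits.CriticalPhenomena.Ising3DConformalLimit.Theorems.MoebiusLimitExists.Negative.EtaExists

/-!
# `MoebiusLimit` (item stmt-CriticalPhenomena-1344) forces two-point RATIO REGULARITY on `ℤ³`

Negative knowledge about the crux `…Theses.EnergyNotSigmaSquared.MoebiusLimit`
(= `PerfectScreening.MoebiusLimitExists`), standing crux disprover (D-0016); THEOREM-ONLY.

`two_point_ratio_asymptotics`: an `O(3)`-invariant, scale-covariant (dimension `Δ`),
non-degenerate pointwise scaling limit of the critical correlators on `ℤ³` forces, for lattice
points `x, y → ∞` with comparable Euclidean norms (`‖ŷ‖/2 ≤ … ≤ 2‖x̂‖`, `x̂ = siteVec x ∈ ℝ³`),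
  `⟨σ₀σ_y⟩_{β_c} / ⟨σ₀σ_x⟩_{β_c} − (‖ŷ‖₂/‖x̂‖₂)^{−2Δ} → 0`   uniformly.
Mechanism: uniform convergence on the compact shell `{(0,w) : 1/4 ≤ ‖w‖_∞ ≤ 8}` at the dyadic
mesh of `x` reaches both `x` and `y`, and the limit there is the explicit `A‖w‖₂^{−2Δ}`
(`two_point_radial`), bounded away from `0` and `∞`. In particular any proof of the crux proves
the OPEN lattice statements "ratio regularity" `⟨σ₀σ_{x+u}⟩/⟨σ₀σ_x⟩ → 1`, "doubling"
`⟨σ₀σ_{2x}⟩/⟨σ₀σ_x⟩ → 2^{−2Δ}` and asymptotic Euclidean isotropy of the critical two-point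
function (corollaries in `RatioRegularCorollaries.lean`).
-/

noncomputable section

namespace Summit.CriticalPhenomena.Ising3DConformalLimit.MoebiusLimitExistsNegative

open Literature.Probability.LatticeModels Filter Set
open scoped Topology

variable {ρ : ℝ → ℝ} {Δ : ℝ} {S : CorrFamily 3}

/-! ### Euclidean versus sup norms -/

/-- A coordinate is bounded by the Euclidean norm. [folklore] -/
theorem abs_apply_le_norm (w : EuclideanSpace ℝ (Fin 3)) (i : Fin 3) : |w i| ≤ ‖w‖ := by
  have := PiLp.norm_apply_le w i
  rwa [Real.norm_eq_abs] at this

/-- If all coordinates are `≤ b` in absolute value then `‖w‖₂ ≤ 2b` (`√3 ≤ 2`). [folklore] -/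
theorem norm_le_two_mul_of_abs_le {w : EuclideanSpace ℝ (Fin 3)} {b : ℝ} (hb : ∀ i, |w i| ≤ b) :
    ‖w‖ ≤ 2 * b := by
  have hb0 : 0 ≤ b := (abs_nonneg _).trans (hb 0)
  rw [EuclideanSpace.norm_eq]
  have hs : ∑ i, ‖w i‖ ^ 2 ≤ (2 * b) ^ 2 := by
    have h' : ∀ i, ‖w i‖ ^ 2 ≤ b ^ 2 := fun i => by
      rw [Real.norm_eq_abs]; exact pow_le_pow_left₀ (abs_nonneg _) (hb i) 2
    rw [Fin.sum_univ_three]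
    nlinarith [h' 0, h' 1, h' 2]
  calc √(∑ i, ‖w i‖ ^ 2) ≤ √((2 * b) ^ 2) := Real.sqrt_le_sqrt hs
    _ = 2 * b := Real.sqrt_sq (by linarith)

/-- `|x̂ᵢ| = |xᵢ|` for the embedded lattice point. [folklore] -/
theorem abs_siteVec_apply (x : Site 3) (i : Fin 3) : |siteVec x i| = ((x i).natAbs : ℝ) := by
  rw [siteVec_apply, Nat.cast_natAbs, Int.cast_abs]

/-- `‖x‖_∞ ≤ ‖x̂‖₂`. [folklore] -/
theorem supNorm_le_norm_siteVec (x : Site 3) : (Site.supNorm x : ℝ) ≤ ‖siteVec x‖ := by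
  obtain ⟨i, hi⟩ := Site.exists_natAbs_eq_supNorm ⟨0, Finset.mem_univ _⟩ x
  have h : ((Site.supNorm x : ℕ) : ℝ) = |siteVec x i| := by rw [abs_siteVec_apply, hi]
  rw [h]
  exact abs_apply_le_norm _ i

/-- `‖x̂‖₂ ≤ 2‖x‖_∞`. [folklore] -/
theorem norm_siteVec_le (x : Site 3) : ‖siteVec x‖ ≤ 2 * Site.supNorm x :=
  norm_le_two_mul_of_abs_le (b := (Site.supNorm x : ℝ)) fun i => by
    rw [abs_siteVec_apply]; exact Nat.cast_le.2 (Site.natAbs_le_supNorm x i)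

/-! ### The shell `{1/4 ≤ ‖w‖_∞ ≤ 8}` -/

/-- Euclidean norm bounds on the shell `{∀ i, |wᵢ| ≤ b} ∩ {∃ i, a ≤ |wᵢ|}`: `a ≤ ‖w‖ ≤ 2b`.
[folklore] -/
theorem norm_mem_Icc_of_shell' {a b : ℝ} {w : EuclideanSpace ℝ (Fin 3)} (hb : ∀ i, |w i| ≤ b)
    (ha : ∃ i, a ≤ |w i|) : a ≤ ‖w‖ ∧ ‖w‖ ≤ 2 * b :=
  ⟨by obtain ⟨i, hi⟩ := ha; exact hi.trans (abs_apply_le_norm w i), norm_le_two_mul_of_abs_le hb⟩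

/-- The configurations `(0, w)`, `w` in a closed coordinate shell, form a compact set. [folklore] -/
theorem isCompact_shell_configs' (a b : ℝ) :
    IsCompact ((fun y : EuclideanSpace ℝ (Fin 3) => (![0, y] : Fin 2 → EuclideanSpace ℝ (Fin 3))) ''
      {y | (∀ i, |y i| ≤ b) ∧ ∃ i, a ≤ |y i|}) := by
  refine IsCompact.image ?_ ?_
  · apply Metric.isCompact_of_isClosed_isBounded
    · have hc : ∀ i : Fin 3, Continuous fun y : EuclideanSpace ℝ (Fin 3) => |y i| := by
        intro i; fun_prop
      have h1 : IsClosed {y : EuclideanSpace ℝ (Fin 3) | ∀ i, |y i| ≤ b} := by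
        rw [Set.setOf_forall]
        exact isClosed_iInter fun i => isClosed_le (hc i) continuous_const
      have h2 : IsClosed {y : EuclideanSpace ℝ (Fin 3) | ∃ i, a ≤ |y i|} := by
        rw [Set.setOf_exists]
        exact isClosed_iUnion_of_finite fun i => isClosed_le continuous_const (hc i)
      rw [Set.setOf_and]
      exact h1.inter h2
    · rw [Metric.isBounded_iff_subset_closedBall 0]
      refine ⟨2 * b, fun y hy => ?_⟩
      rw [Metric.mem_closedBall, dist_zero_right]
      exact (norm_mem_Icc_of_shell' hy.1 hy.2).2
  · refine continuous_pi fun i => ?_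
    fin_cases i
    · simpa using continuous_const
    · exact (continuous_id : Continuous fun y : EuclideanSpace ℝ (Fin 3) => y)

/-- For `2^{k+1} ≤ ‖x‖_∞ < 2^{k+2}` and `‖x̂‖₂/2 ≤ ‖ŷ‖₂ ≤ 2‖x̂‖₂`, the rescaled point `δ_k ŷ`,
`δ_k = 2^{-(k+1)}`, lies in the shell `{1/4 ≤ ‖·‖_∞ ≤ 8}`. [folklore] -/
theorem smul_siteVec_mem_wideShell {k : ℕ} {x y : Site 3} (hlo : 2 ^ (k + 1) ≤ Site.supNorm x)
    (hhi : Site.supNorm x < 2 ^ (k + 2)) (hy1 : ‖siteVec x‖ / 2 ≤ ‖siteVec y‖)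
    (hy2 : ‖siteVec y‖ ≤ 2 * ‖siteVec x‖) :
    (∀ i, |((2:ℝ)⁻¹ ^ (k + 1) • siteVec y) i| ≤ 8) ∧
      ∃ i, 4⁻¹ ≤ |((2:ℝ)⁻¹ ^ (k + 1) • siteVec y) i| := by
  have hδ : (0:ℝ) < 2⁻¹ ^ (k + 1) := by positivity
  have h2k : (2:ℝ)⁻¹ ^ (k + 1) * 2 ^ (k + 1) = 1 := by
    rw [← mul_pow, inv_mul_cancel₀ two_ne_zero, one_pow]
  have hcoord : ∀ i, |((2:ℝ)⁻¹ ^ (k + 1) • siteVec y) i| = 2⁻¹ ^ (k + 1) * |siteVec y i| := by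
    intro i; rw [PiLp.smul_apply, smul_eq_mul, abs_mul, abs_of_pos hδ]
  have hNx : (Site.supNorm x : ℝ) < 2 ^ (k + 2) := by exact_mod_cast hhi
  have hNx' : (2:ℝ) ^ (k + 1) ≤ Site.supNorm x := by exact_mod_cast hlo
  have hxle : ‖siteVec x‖ ≤ 2 * Site.supNorm x := norm_siteVec_le x
  have hxge : (Site.supNorm x : ℝ) ≤ ‖siteVec x‖ := supNorm_le_norm_siteVec x
  constructor
  · intro i
    rw [hcoord i]
    have h1 : |siteVec y i| ≤ ‖siteVec y‖ := abs_apply_le_norm _ i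
    have h3 : |siteVec y i| ≤ 4 * 2 ^ (k + 2) := by nlinarith
    calc (2:ℝ)⁻¹ ^ (k + 1) * |siteVec y i| ≤ 2⁻¹ ^ (k + 1) * (4 * 2 ^ (k + 2)) :=
          mul_le_mul_of_nonneg_left h3 hδ.le
      _ = 8 := by rw [pow_succ (2:ℝ) (k + 1)]; nlinarith [h2k]
  · obtain ⟨i, hi⟩ := Site.exists_natAbs_eq_supNorm ⟨0, Finset.mem_univ _⟩ y
    refine ⟨i, ?_⟩
    rw [hcoord i, abs_siteVec_apply, hi]
    have hyle : ‖siteVec y‖ ≤ 2 * Site.supNorm y := norm_siteVec_le y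
    have h4 : (2:ℝ) ^ (k + 1) / 4 ≤ Site.supNorm y := by linarith
    calc (4:ℝ)⁻¹ = 2⁻¹ ^ (k + 1) * (2 ^ (k + 1) / 4) := by rw [mul_div_assoc', h2k]; norm_num
      _ ≤ 2⁻¹ ^ (k + 1) * Site.supNorm y := mul_le_mul_of_nonneg_left h4 hδ.le

/-- The point `δ_k x̂` itself lies in the wide shell. [folklore] -/
theorem smul_siteVec_mem_wideShell_self {k : ℕ} {x : Site 3} (hlo : 2 ^ (k + 1) ≤ Site.supNorm x)
    (hhi : Site.supNorm x < 2 ^ (k + 2)) :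
    (∀ i, |((2:ℝ)⁻¹ ^ (k + 1) • siteVec x) i| ≤ 8) ∧
      ∃ i, 4⁻¹ ≤ |((2:ℝ)⁻¹ ^ (k + 1) • siteVec x) i| := by
  obtain ⟨h2, i, hi⟩ := smul_siteVec_mem_shell hlo hhi
  exact ⟨fun j => (h2 j).trans (by norm_num), i, le_trans (by norm_num) hi⟩

/-! ### The main estimate -/

/-- **Two-point ratio asymptotics forced by an `O(3)`+scale-covariant non-degenerate limit.**
For every `ε > 0` there is `R` such that for all lattice points `x, y` with `‖x‖_∞ ≥ R` and
`‖x̂‖₂/2 ≤ ‖ŷ‖₂ ≤ 2‖x̂‖₂`: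
`|⟨σ₀σ_y⟩_{β_c}/⟨σ₀σ_x⟩_{β_c} − (‖ŷ‖₂/‖x̂‖₂)^{−2Δ}| ≤ ε`. [folklore] -/
theorem two_point_ratio_asymptotics (hρ : ∀ δ ∈ Set.Ioc (0:ℝ) 1, 0 < ρ δ)
    (hlim : HasPointwiseScalingLimit (criticalCorr 3) ρ S) (hnd : IsNondegenerateTwoPoint S)
    (hrot : IsRotationInvariant S) (hsc : IsScaleCovariant Δ S) {ε : ℝ} (hε : 0 < ε) :
    ∃ R : ℝ, ∀ x y : Site 3, R ≤ ‖x‖ → ‖siteVec x‖ / 2 ≤ ‖siteVec y‖ →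
      ‖siteVec y‖ ≤ 2 * ‖siteVec x‖ →
        |criticalTwoPoint 3 y / criticalTwoPoint 3 x -
          (‖siteVec y‖ / ‖siteVec x‖) ^ (-(2:ℝ) * Δ)| ≤ ε := by
  -- constants
  set A : ℝ := S 2 ![0, EuclideanSpace.single 0 1] with hAdef
  have hA : 0 < A := hnd _ (zero_unitVec_mem_nonCoincident one_ne_zero)
  have hΔ : 1 / 2 ≤ Δ := (scalingDimension_mem_Icc_holds ρ Δ S hlim hsc hnd hρ).1
  have hexp : -(2:ℝ) * Δ ≤ 0 := by linarith
  set m : ℝ := (16:ℝ) ^ (-(2:ℝ) * Δ) * A with hmdef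
  set M : ℝ := (4⁻¹:ℝ) ^ (-(2:ℝ) * Δ) * A with hMdef
  have hm : 0 < m := mul_pos (Real.rpow_pos_of_pos (by norm_num) _) hA
  have hmM : m ≤ M := mul_le_mul_of_nonneg_right
    (Real.rpow_le_rpow_of_nonpos (by norm_num) (by norm_num) hexp) hA.le
  have hM : 0 < M := lt_of_lt_of_le hm hmM
  -- the shell
  set T : Set (EuclideanSpace ℝ (Fin 3)) := {y | (∀ i, |y i| ≤ 8) ∧ ∃ i, 4⁻¹ ≤ |y i|} with hTdef
  set K : Set (Fin 2 → EuclideanSpace ℝ (Fin 3)) :=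
    (fun y : EuclideanSpace ℝ (Fin 3) => (![0, y] : Fin 2 → EuclideanSpace ℝ (Fin 3))) '' T with hKdef
  have hKc : IsCompact K := isCompact_shell_configs' 4⁻¹ 8
  have hTnorm : ∀ w ∈ T, 4⁻¹ ≤ ‖w‖ ∧ ‖w‖ ≤ 16 := fun w hw => by
    have := norm_mem_Icc_of_shell' hw.1 hw.2; exact ⟨this.1, by linarith [this.2]⟩
  have hTne : ∀ w ∈ T, w ≠ 0 := by
    intro w hw h0
    have := (hTnorm w hw).1
    rw [h0, norm_zero] at this
    norm_num at this
  have hKs : K ⊆ NonCoincident 3 2 := by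
    rintro _ ⟨w, hw, rfl⟩
    exact pair_mem_nonCoincident (Ne.symm (hTne w hw))
  -- explicit limit on the shell and its bounds
  have hSw : ∀ w ∈ T, S 2 ![0, w] = ‖w‖ ^ (-(2:ℝ) * Δ) * A := fun w hw =>
    two_point_radial hrot hsc (hTne w hw)
  have hSK : ∀ w ∈ T, m ≤ S 2 ![0, w] ∧ S 2 ![0, w] ≤ M := by
    intro w hw
    obtain ⟨hn1, hn2⟩ := hTnorm w hw
    have hnpos : 0 < ‖w‖ := lt_of_lt_of_le (by norm_num) hn1
    rw [hSw w hw]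
    exact ⟨mul_le_mul_of_nonneg_right (Real.rpow_le_rpow_of_nonpos hnpos hn2 hexp) hA.le,
      mul_le_mul_of_nonneg_right (Real.rpow_le_rpow_of_nonpos (by norm_num) hn1 hexp) hA.le⟩
  -- uniform convergence on K within ε₁
  set ε₁ : ℝ := min (m / 2) (ε * m ^ 2 / (4 * M)) with hε₁def
  have hε₁ : 0 < ε₁ := lt_min (half_pos hm) (by positivity)
  have hε₁m : ε₁ ≤ m / 2 := min_le_left _ _
  have hε₁e : ε₁ ≤ ε * m ^ 2 / (4 * M) := min_le_right _ _
  have hU : TendstoUniformlyOn (rescaledCorrelator (criticalCorr 3) ρ 2) (S 2) (𝓝[>] 0) K :=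
    (tendstoLocallyUniformlyOn_iff_forall_isCompact (isOpen_nonCoincident 3 2)).1 (hlim 2) K hKs hKc
  have hev : ∀ᶠ δ in 𝓝[>] (0:ℝ), ∀ w ∈ T,
      |S 2 ![0, w] - rescaledCorrelator (criticalCorr 3) ρ 2 δ ![0, w]| < ε₁ := by
    filter_upwards [Metric.tendstoUniformlyOn_iff.1 hU ε₁ hε₁] with δ hδ w hw
    have h := hδ _ ⟨w, hw, rfl⟩
    rwa [Real.dist_eq] at h
  obtain ⟨k₀, hk₀⟩ := eventually_atTop.1 (tendsto_dyadicMesh.eventually hev)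
  refine ⟨(2:ℝ) ^ (k₀ + 1), fun x y hR hy1 hy2 => ?_⟩
  -- the dyadic scale of x
  set N := Site.supNorm x with hNdef
  have hnorm : ‖x‖ = (N : ℝ) := Site.norm_eq_supNorm x
  have hge : 2 ^ (k₀ + 1) ≤ N := by
    rw [hnorm] at hR; exact_mod_cast hR
  have hNpos : 0 < N := lt_of_lt_of_le (by positivity) hge
  set k : ℕ := Nat.log 2 N - 1 with hkdef
  have hlogN : k₀ + 1 ≤ Nat.log 2 N := Nat.le_log_of_pow_le one_lt_two hge
  have hk1 : k + 1 = Nat.log 2 N := by omega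
  have hkk₀ : k₀ ≤ k := by omega
  have hlo : 2 ^ (k + 1) ≤ N := by rw [hk1]; exact Nat.pow_log_le_self 2 hNpos.ne'
  have hhi : N < 2 ^ (k + 2) := by
    rw [show k + 2 = (Nat.log 2 N).succ by omega]
    exact Nat.lt_pow_succ_log_self one_lt_two N
  -- the two shell points
  set δ : ℝ := (2:ℝ)⁻¹ ^ (k + 1) with hδdef
  have hδpos : 0 < δ := by positivity
  have hwx : δ • siteVec x ∈ T := smul_siteVec_mem_wideShell_self hlo hhi
  have hwy : δ • siteVec y ∈ T := smul_siteVec_mem_wideShell hlo hhi hy1 hy2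
  have hx_close := hk₀ k hkk₀ _ hwx
  have hy_close := hk₀ k hkk₀ _ hwy
  rw [rescaledCorrelator_zero_smul_siteVec] at hx_close hy_close
  -- notation
  set r : ℝ := ρ δ ^ 2 with hrdef
  set p : ℝ := r * criticalTwoPoint 3 x with hpdef
  set q : ℝ := r * criticalTwoPoint 3 y with hqdef
  set ax : ℝ := S 2 ![0, δ • siteVec x] with haxdef
  set ay : ℝ := S 2 ![0, δ • siteVec y] with haydef
  have hrpos : 0 < r := pow_pos (hρ _ ⟨dyadicMesh_pos k, dyadicMesh_le_one k⟩) 2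
  obtain ⟨hax1, hax2⟩ := hSK _ hwx
  obtain ⟨hay1, hay2⟩ := hSK _ hwy
  have hpx := abs_sub_lt_iff.1 hx_close
  have hpy := abs_sub_lt_iff.1 hy_close
  have hp_pos : 0 < p := by linarith [hpx.1, hpx.2]
  -- the ratio of the explicit limits
  have hxne : siteVec x ≠ 0 := by
    intro h0
    have := supNorm_le_norm_siteVec x
    rw [h0, norm_zero] at this
    have : (0:ℝ) < N := by exact_mod_cast hNpos
    linarith
  have hnx : 0 < ‖siteVec x‖ := norm_pos_iff.2 hxne
  have hratio : ay / ax = (‖siteVec y‖ / ‖siteVec x‖) ^ (-(2:ℝ) * Δ) := by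
    rw [haydef, haxdef, hSw _ hwy, hSw _ hwx, norm_smul, norm_smul, Real.norm_of_nonneg hδpos.le,
      mul_div_mul_right _ _ hA.ne', ← Real.div_rpow (by positivity) (by positivity),
      mul_div_mul_left _ _ hδpos.ne']
  -- `G y / G x = q / p`
  have hGratio : criticalTwoPoint 3 y / criticalTwoPoint 3 x = q / p := by
    rw [hqdef, hpdef, mul_div_mul_left _ _ hrpos.ne']
  rw [hGratio, ← hratio]
  -- the algebra
  have hax_pos : 0 < ax := lt_of_lt_of_le hm hax1
  have hay_pos : 0 < ay := lt_of_lt_of_le hm hay1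
  have key : q / p - ay / ax = ((q - ay) * ax + ay * (ax - p)) / (p * ax) := by
    field_simp
    ring
  rw [key, abs_div, abs_of_pos (mul_pos hp_pos hax_pos), div_le_iff₀ (mul_pos hp_pos hax_pos)]
  have hqa : |q - ay| ≤ ε₁ := by rw [abs_sub_comm]; exact hy_close.le
  have hpa : |ax - p| ≤ ε₁ := hx_close.le
  have hnum : |(q - ay) * ax + ay * (ax - p)| ≤ ε₁ * M + M * ε₁ := by
    refine (abs_add_le _ _).trans ?_
    rw [abs_mul, abs_mul, abs_of_pos hax_pos, abs_of_pos hay_pos]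
    gcongr
  have hden : m / 2 * m ≤ p * ax := by
    have hp' : m / 2 ≤ p := by linarith [hpx.1, hpx.2]
    exact mul_le_mul hp' hax1 hm.le hp_pos.le
  have h1 : ε₁ * M + M * ε₁ ≤ ε * (m / 2 * m) := by
    have : ε₁ * M ≤ ε * m ^ 2 / 4 := by
      calc ε₁ * M ≤ ε * m ^ 2 / (4 * M) * M := mul_le_mul_of_nonneg_right hε₁e hM.le
        _ = ε * m ^ 2 / 4 := by field_simp
    nlinarith
  calc |(q - ay) * ax + ay * (ax - p)| ≤ ε₁ * M + M * ε₁ := hnum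
    _ ≤ ε * (m / 2 * m) := h1
    _ ≤ ε * (p * ax) := mul_le_mul_of_nonneg_left hden hε.le

end Summit.CriticalPhenomena.Ising3DConformalLimit.MoebiusLimitExistsNegative

end
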